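import Summits.BirchSwinnertonDyer.BirchSwinnertonDyer.Theorems.SylvesterTwoHeegnerIndexUpperOffV0KolyvaginClassesAssemblyOfH44
import Summits.BirchSwinnertonDyer.BirchSwinnertonDyer.Theorems.SylvesterTwoHeegnerIndexUpperOffV0RingClassAdmissibleTwo
import HarnessLib

/-!
# K7t crux `UpperOffV0HSYPlus` (item 19804), line `offv0-kolyvagin2`: stub (d) AT `p = 2` for the
# Sylvester models — Kolyvagin's derivative classes ASSEMBLED, admissibility discharged

Helper file of route `SylvesterTwoHeegnerIndex` (cell bsd-cm, rung K7t); the `p := 2` specialisation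
of k7t-c2 g6's `hpoints_at_of_perLevelChoice_of_admissible_of_h44` (x11b3's per-level-choice assembly
of the `hpoints` binder, re-run for any prime with `hA` and McCallum's clause (f) as labelled inputs)
with the admissibility input `hAdm` DISCHARGED by `isAdmissible_pointsSubgroup_two` (`ω ∉ K[n]` at the
Kolyvagin levels: they are prime to `3 ∣ N`, and `3` splits in the Heegner field).

What is proved: `hpoints_at_two_of_perLevelChoice_sylvester` — for `W` a globally minimal `ℚ`-model
of `E_p` at its conductor `N` (`3 ∣ N`), `K` imaginary quadratic (`d_K ∉ {−3,−4}`, Heegner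
hypothesis), `P` a Heegner point: the registered stub (d) `stub_kolyvaginClasses_two`'s conclusion AT
THIS FRAME, CONDITIONAL on the four cite-only printed inputs {`hrec`, `hCM`, `h53`, `hGZ`} of the
odd-`p` X11b road taken at `2` (Shimura reciprocity at conductor `1`, CM rationality of `x_m` over
`K_m`, Gross Prop. 5.3, GZ86 III (3.1)) and on ONE `2`-adic local clause `h44` — McCallum Prop. 4.4
at `λ ∣ m` for `E_p` in concrete tower currency (at the supersingular Kolyvagin primes of `E_p` the
printed "cyclic eigenspace" step is to be replaced by "`Ẽ(𝔽_{ℓ²}) = Ẽ[ℓ+1]` free of rank `2`",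
memo STUB-AUDIT-19804 §2; NOT proved here).

HONEST FRAMING: an ASSEMBLY (x11b3's mathematics, `Rank1Residual/X11b/KolyvaginHpointsAssemblyAt`);
stub (d) as REGISTERED (all `W`, no inputs) is NOT closed; no definition, no named fact, no `sorry`;
B14 = O12 open as a class; BSD not claimed.  References: [GrossLMS1991] §3–§6; [McCallumLMS1991] §1,
§4; [GrossZagier1986] III (3.1); [Darmon2004] Thm. 3.7, Prop. 3.11.
-/

set_option autoImplicit false
set_option linter.dupNamespace false

noncomputable section

open scoped Classical
open WeierstrassCurve Field NumberField IsDedekindDomain Finset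
open Literature.NumberTheory.EllipticCurves Literature.NumberTheory.GaloisRepresentations
open Literature.NumberTheory.EllipticCurves.KolyvaginCocycle
open Literature.NumberTheory.EllipticCurves.KolyvaginEuler
open Literature.NumberTheory.EllipticCurves.RingClassField
open Literature.NumberTheory.EllipticCurves.ModularForms
open Summit.BirchSwinnertonDyer.Rank1Residual.X11b
open Summit.BirchSwinnertonDyer.Rank1Residual.X11b.KolyvaginAssembly

namespace Summit.BirchSwinnertonDyer.BirchSwinnertonDyer.Theorems.SylvesterTwoUpper

-- `K : Type`: the tree's ring-class class field theory is universe `0`.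
variable {K : Type} [Field K] [NumberField K] {N : ℕ} {W : WeierstrassCurve ℚ}

/-- **Stub (d) `stub_kolyvaginClasses_two` RESTRICTED to the Sylvester family — Kolyvagin's derivative
classes AT `p = 2` ASSEMBLED**: for `W` a globally minimal `ℚ`-model of `E_p` (`p` an odd prime,
`C • W = cubeSumCurve p`) at its conductor `N` with `3 ∣ N`, `K` imaginary quadratic with
`d_K ∉ {−3, −4}` and the Heegner hypothesis, `P` a Heegner point of level `N`: the `hpoints` binder of
the `2`-adic descent (`sha_two_primary_exponent_of_pointsM_of_reciprocityM`, k7t-c2 g4) — for every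
`M ≥ 1`, `hdiv` and the complex conjugation `c ≠ 1`, the data `(ε, τ, A, P_m)` with clauses (a)–(f) —
CONDITIONAL on the four cite-only printed inputs {`hrec`, `hCM`, `h53`, `hGZ`} of the odd-`p` road AT
`2` and on the ONE `2`-adic local clause `h44` (McCallum Prop. 4.4 at `λ ∣ m` for `E_p`; NOT proved
here), with the admissibility input DISCHARGED (`isAdmissible_pointsSubgroup_two`: every Kolyvagin
level is prime to `3 ∣ N`, and `3 ∤ d_K` since `3` splits in `K`).  ASSEMBLY; (d) as registered is
NOT closed. [cite: GrossLMS1991, §4 (4.1), Lemma 4.3, Props. 5.3, 5.4 (1), 6.2]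
[cite: McCallumLMS1991, §1 Theorem (Kolyvagin), §4 (4)–(6), Prop. 4.4] [cite: GrossZagier1986, III (3.1)] -/
theorem hpoints_at_two_of_perLevelChoice_sylvester [NeZero N] [W.IsGloballyMinimal] [W.IsElliptic]
    (hN : N = W.conductorNorm ℤ) (hK : IsImaginaryQuadratic K)
    (hD34 : NumberField.discr K ≠ -3 ∧ NumberField.discr K ≠ -4)
    (hH : SatisfiesHeegnerHypothesis N K) {P : (W.baseChange K).toAffine.Point}
    (hHP : IsHeegnerPoint N W K P) {p : ℕ} (hp : p.Prime) (hp2 : p ≠ 2)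
    (hW : ∃ C : VariableChange ℚ, C • W = HuShuYin2019.cubeSumCurve (p : ℚ)) (h3N : 3 ∣ N)
    (hrec : heegnerPointOfConductor_one_galoisConj N W K)
    (hCM : ∀ [W.IsElliptic] (_hK : IsImaginaryQuadratic K) (_hH : SatisfiesHeegnerHypothesis N K)
      (Dt : ModularParametrizationData W N) (β : ℤ) (ι : K →+* ℂ),
      (4 * N : ℤ) ∣ β ^ 2 - NumberField.discr K →
      ∀ {M : ℕ}, 1 ≤ M → ∀ (m : ℕ), Squarefree m →
      (∀ q ∈ m.primeFactors, IsKolyvaginPrime N W K 2 q ∧ FrobEqFrobInfty W K (2 ^ M) q) →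
      ∃ y : (W.baseChange (ringClassField K ι m)).toAffine.Point,
        WeierstrassCurve.Affine.Point.map (W' := W) (ringClassField K ι m).subtype.toRatAlgHom y =
          heegnerPointComplexOfConductor Dt (NumberField.discr K) β m)
    (h53 : ∀ [W.IsElliptic] (_hK : IsImaginaryQuadratic K) (_hH : SatisfiesHeegnerHypothesis N K)
      (Dt : ModularParametrizationData W N) (β : ℤ) (ι : K →+* ℂ) {M : ℕ}
      (_hM : 1 ≤ M) {n : ℕ} (_hn : Squarefree n)
      (_hKol : ∀ q ∈ n.primeFactors, IsKolyvaginPrime N W K 2 q ∧ FrobEqFrobInfty W K (2 ^ M) q)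
      (d : (m : ℕ) → m ∣ n → KolyvaginHeegnerData Dt β ι m) (m : ℕ) (hm : m ∣ n)
      (τm : ringClassField K ι m ≃ₐ[ℚ] ringClassField K ι m),
      (∀ x : ringClassField K ι m, ((τm x : ringClassField K ι m) : ℂ) = starRingEnd ℂ x) →
      ∃ σ' ∈ ringClassGal ι m, IsOfFinAddOrder
        (pointGalHom W (ringClassField K ι m) τm (d m hm).y -
          (-W.rootNumber) • pointGalHom W (ringClassField K ι m) σ' (d m hm).y))
    (hGZ : ∀ [W.IsElliptic] (_hK : IsImaginaryQuadratic K) (_hH : SatisfiesHeegnerHypothesis N K)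
      (Dt : ModularParametrizationData W N) (β : ℤ) (ι : K →+* ℂ) {M : ℕ} (_hM : 1 ≤ M) {n : ℕ}
      (_hn : Squarefree n)
      (_hKol : ∀ q ∈ n.primeFactors, IsKolyvaginPrime N W K 2 q ∧ FrobEqFrobInfty W K (2 ^ M) q)
      (d : (m : ℕ) → m ∣ n → KolyvaginHeegnerData Dt β ι m),
      ∃ n' : ℤ, IsCoprime ((2 ^ M : ℕ) : ℤ) n' ∧
        ∀ (m : ℕ) (hm : m ∣ n) (γ : ringClassField K ι m ≃ₐ[ℚ] ringClassField K ι m),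
          γ ∈ ringClassGal ι m → ∀ v : HeightOneSpectrum (𝓞 K),
            ¬ (W.baseChange K).HasGoodReductionAt v →
            n' • pointsMap (W.baseChange K) (v.adicCompletion K)
                ((d m hm).toGeomPoints (pointGalHom W (ringClassField K ι m) γ (d m hm).y)) ∈
              E0Receptacle (W.baseChange K) v ∧
            ∀ (ℓ : ℕ) (hℓ : ℓ ∈ m.primeFactors)
              (hle : ringClassField K ι (m / ℓ) ≤ ringClassField K ι m),
              n' • pointsMap (W.baseChange K) (v.adicCompletion K)
                  ((d m hm).toGeomPoints (pointGalHom W (ringClassField K ι m) γ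
                    (WeierstrassCurve.Affine.Point.map (W' := W)
                      ((RingClassField.inclusion ι hle).restrictScalars ℚ)
                      (d (m / ℓ)
                        ((Nat.div_dvd_of_dvd (Nat.dvd_of_mem_primeFactors hℓ)).trans hm)).y))) ∈
                E0Receptacle (W.baseChange K) v)
    (h44 : ∀ [W.IsElliptic] [W.IsGloballyMinimal] (_hK : IsImaginaryQuadratic K) (ι : K →+* ℂ)
      {P : (W.baseChange K).toAffine.Point} (_hHP : IsHeegnerPoint N W K P) {M : ℕ} (_hM : 1 ≤ M)
      (Dt : ModularParametrizationData W N) {β : ℤ}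
      (_hND : IsCoprime (N : ℤ) (NumberField.discr K)) (_hD : NumberField.discr K < -4)
      {n : ℕ} (_hn : Squarefree n)
      (_hKol : ∀ q ∈ n.primeFactors, IsKolyvaginPrime N W K 2 q ∧ FrobEqFrobInfty W K (2 ^ M) q)
      (d : (m : ℕ) → m ∣ n → KolyvaginHeegnerData Dt β ι m)
      (_hcoh : ∀ (m : ℕ) (hm : m ∣ n) (ℓ : ℕ) (hℓ : ℓ ∈ m.primeFactors)
        (hle : ringClassField K ι (m / ℓ) ≤ ringClassField K ι m),
        letI : Algebra K ℂ := ι.toAlgebra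
        (d m hm).toGeomPoints
            (KolyvaginOperator.derivedPoint (pointGalHom W (ringClassField K ι m)) (d m hm).σ (m / ℓ)
              (d m hm).S
              (WeierstrassCurve.Affine.Point.map (W' := W)
                ((RingClassField.inclusion ι hle).restrictScalars ℚ)
                (d (m / ℓ) ((Nat.div_dvd_of_dvd (Nat.dvd_of_mem_primeFactors hℓ)).trans hm)).y)) =
          (d (m / ℓ) ((Nat.div_dvd_of_dvd (Nat.dvd_of_mem_primeFactors hℓ)).trans hm)).toGeomPoints
            (d (m / ℓ) ((Nat.div_dvd_of_dvd (Nat.dvd_of_mem_primeFactors hℓ)).trans hm)).derivedPoint)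
      (_hA : ∀ (m : ℕ) (hm : m ∣ n),
        IsAdmissible (absoluteGaloisGroup K) (d m hm).pointsSubgroup ((2 ^ M : ℕ) : ℤ))
      (_hPt : ∀ (m : ℕ) (hm : m ∣ n),
        (d m hm).toGeomPoints (d m hm).derivedPoint ∈
          invPoints (absoluteGaloisGroup K) (d m hm).pointsSubgroup ((2 ^ M : ℕ) : ℤ))
      (_hI : ∀ (m : ℕ) (hm : m ∣ n), ∀ v : HeightOneSpectrum (𝓞 K), (m : 𝓞 K) ∉ v.asIdeal →
        ∀ 𝔐 ∈ v.localPrimesAbove, ∀ t ∈ 𝔐.inertia (absoluteGaloisGroup (v.adicCompletion K)),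
          resGal (K := K) (v.adicCompletion K) t • (d m hm).toGeomPoints (d m hm).derivedPoint =
            (d m hm).toGeomPoints (d m hm).derivedPoint),
      ∀ (m : ℕ) (hm : m ∣ n) (ℓ : ℕ), ℓ.Prime → ∀ (hℓm : ℓ ∣ m) (v : HeightOneSpectrum (𝓞 K)),
        (ℓ : 𝓞 K) ∈ v.asIdeal → ∀ a : ℕ,
          ((((2 : ℕ) : ℤ) ^ a) • (d m hm).kolyvaginClass Nat.prime_two M ∈
              selmerLocalKer (W.baseChange K) (v.adicCompletion K) ((2 ^ M : ℕ) : ℤ) ↔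
            (((2 : ℕ) : ℤ) ^ a) • (d (m / ℓ) ((Nat.div_dvd_of_dvd hℓm).trans hm)).kolyvaginClass Nat.prime_two M ∈
              (W.baseChange K).torsionLocalKer (v.adicCompletion K) ((2 ^ M : ℕ) : ℤ))) :
    ∀ {M : ℕ} (_hM : 1 ≤ M)
      (hdiv : ∀ Q : geomPoints (W.baseChange K), ∃ R, ((2 ^ M : ℕ) : ℤ) • R = Q)
      (c : K ≃ₐ[ℚ] K) (_hc : c ≠ 1),
      ∃ (ε : ℤ) (τ : AlgebraicClosure K ≃+* AlgebraicClosure K) (hτ : IsLiftOfAut c τ)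
        (A : ℕ → AddSubgroup (geomPoints (W.baseChange K)))
        (hA : ∀ m, KolyvaginCocycle.IsAdmissible (Field.absoluteGaloisGroup K) (A m)
          ((2 ^ M : ℕ) : ℤ))
        (Pt : ℕ → geomPoints (W.baseChange K))
        (hPt : ∀ m, Pt m ∈
          KolyvaginCocycle.invPoints (Field.absoluteGaloisGroup K) (A m) ((2 ^ M : ℕ) : ℤ)),
        (ε = 1 ∨ ε = -1) ∧
        IsOfFinAddOrder (Affine.Point.map (W' := W) (c : K →ₐ[ℚ] K) P - ε • P) ∧
        (∀ m, ∀ a ∈ A m, hτ.pointsMap W a ∈ A m) ∧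
        Pt 1 = toGeomPoints (W.baseChange K) P ∧
        (∀ m : ℕ, Squarefree m →
          (∀ q ∈ m.primeFactors, IsKolyvaginPrime N W K 2 q ∧ FrobEqFrobInfty W K (2 ^ M) q) →
          (∃ B ∈ A m, hτ.pointsMap W (Pt m) =
            (ε * (-1) ^ m.primeFactors.card) • Pt m + ((2 ^ M : ℕ) : ℤ) • B) ∧
          (∀ v : HeightOneSpectrum (𝓞 K), (m : 𝓞 K) ∉ v.asIdeal →
            kolyvaginClass (W.baseChange K) _ hdiv (hA m) (Pt m) (hPt m) ∈
              selmerLocalKer (W.baseChange K) (v.adicCompletion K) ((2 ^ M : ℕ) : ℤ)) ∧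
          (∀ ℓ : ℕ, ℓ.Prime → ℓ ∣ m → ∀ v : HeightOneSpectrum (𝓞 K), (ℓ : 𝓞 K) ∈ v.asIdeal →
            ∀ a : ℕ, ((((2 : ℕ) : ℤ) ^ a) •
                kolyvaginClass (W.baseChange K) _ hdiv (hA m) (Pt m) (hPt m) ∈
                selmerLocalKer (W.baseChange K) (v.adicCompletion K) ((2 ^ M : ℕ) : ℤ) ↔
              (((2 : ℕ) : ℤ) ^ a) • kolyvaginClass (W.baseChange K) _ hdiv (hA (m / ℓ)) (Pt (m / ℓ))
                  (hPt (m / ℓ)) ∈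
                (W.baseChange K).torsionLocalKer (v.adicCompletion K) ((2 ^ M : ℕ) : ℤ)))) := by
  intro M hM hdiv c hc
  -- `hAdm` AT `2` for the Sylvester models: the Kolyvagin levels are prime to `3 ∣ N`, and `3 ∤ d_K`
  have h3D : ¬ (3 : ℤ) ∣ NumberField.discr K :=
    not_dvd_discr_of_satisfiesHeegnerHypothesis hK hH Nat.prime_three h3N
  have hAdm : ∀ (Dt : ModularParametrizationData W N) (β : ℤ) (ι : K →+* ℂ) {M : ℕ} {n : ℕ},
      Squarefree n →
      (∀ q ∈ n.primeFactors, IsKolyvaginPrime N W K 2 q ∧ FrobEqFrobInfty W K (2 ^ M) q) →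
      ∀ d : KolyvaginHeegnerData Dt β ι n,
        IsAdmissible (absoluteGaloisGroup K) d.pointsSubgroup ((2 ^ M : ℕ) : ℤ) := by
    intro Dt β ι M n hn hKol d
    have hn0 : n ≠ 0 := Squarefree.ne_zero hn
    have h3n : ¬ 3 ∣ n := fun h3 ↦
      (hKol 3 (Nat.mem_primeFactors.mpr ⟨Nat.prime_three, h3, hn0⟩)).1.2.1 h3N
    exact isAdmissible_pointsSubgroup_two d hp hp2 hW hK hn0 h3n h3D M
  exact hpoints_at_of_perLevelChoice_of_admissible_of_h44 hN hK hD34 hH hHP Nat.prime_two hrec hCM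
    h53 hGZ hAdm h44 hM hdiv c hc

end Summit.BirchSwinnertonDyer.BirchSwinnertonDyer.Theorems.SylvesterTwoUpper

end
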